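/-
Copyright (c) 2026 the pub-hodgecm-mathlib formalisation cell (harness21).  Prover seat hodgecm-mathlib-K2Liu-p08 (g4), Track B «K2-LIT» ∕ hLiu418
#184♮, socket #42S organ S1 (ROAD W), brick F8 (B5)-split (LEAD BATCH #23 «p08 split twin»; the split twin of K2E5-p12's ★ (B5)
`K2LiuLocalSWDualBoxIndex`, whose place-generic §1 letters are reused BY NAME).  2026-09-04.  KERNEL: theorems only.
-/
import Summits.HodgeConjecture.HodgeConjecture.Theorems.K2LiuLocalSWDualBoxIndex        -- ★ (B5): `map_conj_mul_eq_neg_transpose_iff`, `existsUnique_diag_coord`, ball bridges, `exists_skew_with_coords`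
import Summits.HodgeConjecture.HodgeConjecture.Theorems.K2LiuSplitWitnessDuality        -- ★ p860775: `smul_ne_of_split`
import HarnessLib

/-!
# Crux `HLiu418`, #42S-S1 ROAD W, brick (B5)-split: `[𝔰 ∩ Λ_m : 𝔰 ∩ Λ_0] = q_v^{4m}` AT A SPLIT PLACE (the `hcard` letter of ★ (J)-split)

Cell `hodgecm-mathlib`, crux item hLiu418 = `stmt-HodgeConjecture-24832` (helper lane `--supports … --as helper`, count-neutral).  THEOREMS ONLY (no `def`, no instance,
no notation, no named-fact hypothesis, no `sorry`).  The SPLIT twin of ★ (B5) `K2LiuLocalSWDualBoxIndex.card_quotient_inf_box_eq_pow` (which assumes `c • w₀ = w₀`):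
at a place `v` SPLIT in `E∕F` (`w₀`, `c • w₀ ≠ w₀`, `w̄₀ = galInv c w₀` the other place, `|π|_v = exp(−1)` so `|ι_wπ|_w = exp(−1)` at both `w`), for `t ∈ 𝔰` with
`K = 𝕋t` skew-hermitian the box `Λ_j` reads on FOUR coordinates `(b₀, b₁, (K_01)_{w₀}, (K_01)_{w̄₀}) ∈ (L_v)² × E_{w₀} × E_{w̄₀}` (the diagonal coordinates of ★ (B5), the
off-diagonal entry read at BOTH places; `K_10 = −σK_01` is automatic), so `t ↦ coordinates` is an additive surjection `𝔰 ∩ Λ_{k+1} ↠ (𝔭_v^a⁄𝔭_v^{a+1})² × 𝔭_{w₀}^{a′}⁄𝔭_{w₀}^{a′+1} ×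
𝔭_{w̄₀}^{a′}⁄𝔭_{w̄₀}^{a′+1}` with kernel `𝔰 ∩ Λ_k`: index `q·q·q_{w₀}·q_{w̄₀} = q⁴` (`q_w = q_v` at split `w`, ★ `residueCard_eq_of_split`) — the same count as at an inert place.
* `valued_toPlace_eq_of_split`, **`mem_box_iff_coords_split`**, **`relIndex_inf_box_succ_split`** (`= q_v⁴`), **`relIndex_inf_box_eq_pow_split`**,
  ★★ **`card_quotient_inf_box_eq_pow_split : Fintype.card (𝔰 ∩ Λ_m ⧸ 𝔰 ∩ Λ_0) = q_v^{4m}`** — the `hcard` letter of ★ (J)-split `sum_profile_eq_shape_split` ∕ `sum_two_depths_ne_zero`.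
[Shimura1997, §13.2, §13.5] [BushnellHenniart2006, §1.1] [CasselsFrohlichANT1967, Ch. II §10, Ch. VII Prop. 1.2].
HONEST LABEL.  Count-neutral helper; `HC_CM` is proved only modulo the 7 printed citations (2 remaining named inputs: hLiu418 = `stmt-HodgeConjecture-24832`,
h413 = `stmt-HodgeConjecture-24833`) until rung 0 closes.

## References
* [Shimura1997] G. Shimura, CBMS 93 (1997), §13.2, §13.5.   * [BushnellHenniart2006] C. Bushnell, G. Henniart, Grundlehren 335 (2006), §1.1.
* [CasselsFrohlichANT1967] Cassels–Fröhlich (1967), Ch. II §10, Ch. VII Prop. 1.2.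
-/

set_option autoImplicit false
set_option linter.dupNamespace false -- the mandated namespace repeats `HodgeConjecture.HodgeConjecture`

noncomputable section

open scoped Matrix
open NumberField IsDedekindDomain Matrix Set
open Literature.NumberTheory.GaloisRepresentations.IsNonarchimedeanLocalField
open Literature.NumberTheory.Automorphic Literature.NumberTheory.Automorphic.UnitaryGroup
open Literature.NumberTheory.GelbartRogawski1991.UnitaryDualPair.LocalSplitting
open Summit.HodgeConjecture.HodgeConjecture.Cruxes.HLiu418.K2LiuLocalRingValuationBalls
open Summit.HodgeConjecture.HodgeConjecture.Cruxes.HLiu418.K2LiuLatticePairCellCount (natCard_quotient_ker)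
open Summit.HodgeConjecture.HodgeConjecture.Cruxes.HLiu418.K2LiuLocalBallIndices
open Summit.HodgeConjecture.HodgeConjecture.Cruxes.HLiu418.K2LiuLocalSWDualBoxes (box_mono)
open Summit.HodgeConjecture.HodgeConjecture.Cruxes.HLiu418.K2LiuGoodPlaceWhittakerUnimodularValueCM (residueCard_eq_of_split)
open Summit.HodgeConjecture.HodgeConjecture.Cruxes.HLiu418.K2LiuLocalSWDualBoxIndex
open Summit.HodgeConjecture.HodgeConjecture.Cruxes.HLiu418.K2LiuSplitWitnessDuality (smul_ne_of_split)

namespace Summit.HodgeConjecture.HodgeConjecture.Cruxes.HLiu418.K2LiuLocalSWDualBoxIndexSplit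

variable (F : Type) [Field F] [NumberField F] (E : Type) [Field E] [NumberField E] [Algebra F E] [Algebra.IsQuadraticExtension F E]
  (c : E ≃ₐ[F] E) {δ : E} (hcδ : c δ = -δ) (hδ : δ ≠ 0)
  (v : HeightOneSpectrum (𝓞 F)) {π : v.adicCompletion F} (hπ : Valued.v π = WithZero.exp (-1 : ℤ))
  {T₀ : Matrix (Fin 2) (Fin 2) F} (hT₀ : T₀.IsSymm) (hT₀d : IsUnit T₀.det)
  (S : AddSubgroup (Matrix (Fin 2) (Fin 2) (LocalRing E v)))
  (hS : ∀ t, t ∈ S ↔ (t.map (conjLocal E c v))ᵀ * gramS F E v 2 T₀ + gramS F E v 2 T₀ * t = 0)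
  (w₀ : PlacesOver E v) (hw₀ : c • w₀.1 ≠ w₀.1)

/-! ## §1 The box in the four split coordinates -/

include hπ hw₀ in
/-- at a split `v` every `w ∣ v` is unramified: `|ι_wπ|_w = exp(−1)` (★ `valued_toPlace_of_split`, both places split ★ `smul_ne_of_split`). [cite: CasselsFrohlichANT1967, Ch. VII Prop. 1.2] -/
theorem valued_toPlace_eq_of_split (w : PlacesOver E v) : Valued.v (toPlace v w π) = WithZero.exp (-1 : ℤ) := by
  rw [valued_toPlace_of_split F E c v w (smul_ne_of_split F E c v w₀ hw₀ w) π, hπ]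

include hπ hw₀ in
/-- **THE BOX IN SPLIT COORDINATES** (`δ̂` a `v`-unit): for `K = 𝕋t` skew-hermitian with diagonal coordinates `b₀, b₁`,
`t ∈ BOX m ⟺ b₀, b₁ ∈ 𝔭_v^{c₀−m−e₂} ∧ (K_01)_{w₀} ∈ 𝔭_{w₀}^{c₀−m} ∧ (K_01)_{w̄₀} ∈ 𝔭_{w̄₀}^{c₀−m}` (`K_10 = −σK_01`, ★ `ball_conjLocal`). [cite: Shimura1997, §13.5] -/
theorem mem_box_iff_coords_split (hδu : ∀ w : PlacesOver E v, Valued.v (algebraMap E (LocalRing E v) δ w) = 1) (c₀ e₂ m : ℤ)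
    {t : Matrix (Fin 2) (Fin 2) (LocalRing E v)} (hskew : (gramS F E v 2 T₀ * t).map (conjLocal E c v) = -(gramS F E v 2 T₀ * t)ᵀ)
    {b₀ b₁ : v.adicCompletion F} (hb₀ : (gramS F E v 2 T₀ * t) 0 0 = toLocalRing E v b₀ * algebraMap E (LocalRing E v) δ)
    (hb₁ : (gramS F E v 2 T₀ * t) 1 1 = toLocalRing E v b₁ * algebraMap E (LocalRing E v) δ) :
    t ∈ {t : Matrix (Fin 2) (Fin 2) (LocalRing E v) | ∀ i j (w : PlacesOver E v),
        Valued.v ((algebraMap E (LocalRing E v) δ • (gramS F E v 2 T₀ * t)) i j w) ≤ Valued.v (toPlace v w π) ^ (c₀ - m - if i = j then e₂ else 0)} ↔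
      b₀ ∈ primePowBall (v.adicCompletion F) (c₀ - m - e₂) ∧ b₁ ∈ primePowBall (v.adicCompletion F) (c₀ - m - e₂) ∧
        (gramS F E v 2 T₀ * t) 0 1 w₀ ∈ primePowBall (w₀.1.adicCompletion E) (c₀ - m) ∧
        (gramS F E v 2 T₀ * t) 0 1 (PlacesOver.galInv c w₀) ∈ primePowBall ((PlacesOver.galInv c w₀).1.adicCompletion E) (c₀ - m) := by
  have hc : c ≠ 1 := fun h => hw₀ (by rw [h, one_smul])
  have hVw := valued_toPlace_eq_of_split F E c v hπ w₀ hw₀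
  -- `|(δ̂K)_ij|_w = |K_ij|_w`
  have hsm : ∀ i j (w : PlacesOver E v), Valued.v ((algebraMap E (LocalRing E v) δ • (gramS F E v 2 T₀ * t)) i j w) = Valued.v ((gramS F E v 2 T₀ * t) i j w) := by
    intro i j w
    rw [Matrix.smul_apply, smul_eq_mul, Pi.mul_apply, map_mul, hδu w, one_mul]
  -- `K_10 = −σ(K_01)`
  have h10 : (gramS F E v 2 T₀ * t) 1 0 = -conjLocal E c v ((gramS F E v 2 T₀ * t) 0 1) := by
    have h := congrFun (congrFun hskew 0) 1
    rw [Matrix.map_apply, Matrix.neg_apply, Matrix.transpose_apply] at h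
    rw [h, neg_neg]
  rw [Set.mem_setOf_eq]
  constructor
  · intro h
    refine ⟨?_, ?_, ?_, ?_⟩
    · have h00 := h 0 0 w₀
      rw [hsm, if_pos rfl, hb₀] at h00
      exact (valued_coord_le_iff F E v hπ hδu _ b₀ w₀).1 h00
    · have h11 := h 1 1 w₀
      rw [hsm, if_pos rfl, hb₁] at h11
      exact (valued_coord_le_iff F E v hπ hδu _ b₁ w₀).1 h11
    · have h01 := h 0 1 w₀
      rw [hsm, if_neg Fin.zero_ne_one, sub_zero] at h01
      exact (valued_le_iff_mem_primePowBall F E v (hVw w₀) _ _).1 h01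
    · have h01 := h 0 1 (PlacesOver.galInv c w₀)
      rw [hsm, if_neg Fin.zero_ne_one, sub_zero] at h01
      exact (valued_le_iff_mem_primePowBall F E v (hVw (PlacesOver.galInv c w₀)) _ _).1 h01
  · rintro ⟨h0, h1, h01, h01'⟩ i j w
    rw [hsm]
    have h01w : ∀ w' : PlacesOver E v, Valued.v ((gramS F E v 2 T₀ * t) 0 1 w') ≤ Valued.v (toPlace v w' π) ^ (c₀ - m) := by
      intro w'
      rcases PlacesOver.eq_or_eq_galInv c hc w₀ w' with rfl | rfl
      · exact (valued_le_iff_mem_primePowBall F E v (hVw _) _ _).2 h01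
      · exact (valued_le_iff_mem_primePowBall F E v (hVw _) _ _).2 h01'
    fin_cases i <;> fin_cases j
    · show Valued.v ((gramS F E v 2 T₀ * t) 0 0 w) ≤ Valued.v (toPlace v w π) ^ (c₀ - m - if (0 : Fin 2) = 0 then e₂ else 0)
      rw [if_pos rfl, hb₀]
      exact (valued_coord_le_iff F E v hπ hδu _ b₀ w).2 h0
    · show Valued.v ((gramS F E v 2 T₀ * t) 0 1 w) ≤ Valued.v (toPlace v w π) ^ (c₀ - m - if (0 : Fin 2) = 1 then e₂ else 0)
      rw [if_neg (show (0 : Fin 2) ≠ 1 by decide), sub_zero]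
      exact h01w w
    · show Valued.v ((gramS F E v 2 T₀ * t) 1 0 w) ≤ Valued.v (toPlace v w π) ^ (c₀ - m - if (1 : Fin 2) = 0 then e₂ else 0)
      rw [if_neg (show (1 : Fin 2) ≠ 0 by decide), sub_zero, h10]
      exact ball_neg F E v (ball_conjLocal F E c v h01w) w
    · show Valued.v ((gramS F E v 2 T₀ * t) 1 1 w) ≤ Valued.v (toPlace v w π) ^ (c₀ - m - if (1 : Fin 2) = 1 then e₂ else 0)
      rw [if_pos rfl, hb₁]
      exact (valued_coord_le_iff F E v hπ hδu _ b₁ w).2 h1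

/-! ## §2 The one-step index `[𝔰 ∩ Λ_{k+1} : 𝔰 ∩ Λ_k] = q_v⁴` at a split place -/

set_option maxHeartbeats 400000 in
include hcδ hδ hπ hT₀ hT₀d hS hw₀ in
/-- **`[𝔰 ∩ Λ_{k+1} : 𝔰 ∩ Λ_k] = q_v⁴` AT A SPLIT PLACE**: the coordinate map `t ↦ (b₀, b₁, (K_01)_{w₀}, (K_01)_{w̄₀})` is an additive surjection
`𝔰 ∩ Λ_{k+1} ↠ (𝔭_v^a⁄𝔭_v^{a+1})² × 𝔭_{w₀}^{a′}⁄𝔭_{w₀}^{a′+1} × 𝔭_{w̄₀}^{a′}⁄𝔭_{w̄₀}^{a′+1}` with kernel `𝔰 ∩ Λ_k` (lift: ★ `exists_skew_with_coords` with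
`z := 1_{w₀}ζ + 1_{w̄₀}ζ′`); ★ `natCard_quotient_ker`, ★ `relIndex_eq_residueFieldCard`, `q_{w₀} = q_{w̄₀} = q_v` ★ `residueCard_eq_of_split`.
[cite: Shimura1997, §13.2, §13.5] [cite: BushnellHenniart2006, §1.1] -/
theorem relIndex_inf_box_succ_split (hδu : ∀ w : PlacesOver E v, Valued.v (algebraMap E (LocalRing E v) δ w) = 1) (c₀ e₂ k : ℤ)
    {Λ₀ Λ₁ : AddSubgroup (Matrix (Fin 2) (Fin 2) (LocalRing E v))}
    (hΛ₀ : (Λ₀ : Set (Matrix (Fin 2) (Fin 2) (LocalRing E v))) = {t | ∀ i j (w : PlacesOver E v),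
      Valued.v ((algebraMap E (LocalRing E v) δ • (gramS F E v 2 T₀ * t)) i j w) ≤ Valued.v (toPlace v w π) ^ (c₀ - k - if i = j then e₂ else 0)})
    (hΛ₁ : (Λ₁ : Set (Matrix (Fin 2) (Fin 2) (LocalRing E v))) = {t | ∀ i j (w : PlacesOver E v),
      Valued.v ((algebraMap E (LocalRing E v) δ • (gramS F E v 2 T₀ * t)) i j w) ≤ Valued.v (toPlace v w π) ^ (c₀ - (k + 1) - if i = j then e₂ else 0)}) :
    (S ⊓ Λ₀).relIndex (S ⊓ Λ₁) = v.residueCard ^ 4 := by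
  classical
  have hne : PlacesOver.galInv c w₀ ≠ w₀ := PlacesOver.galInv_ne c w₀ hw₀
  -- the one-dimensional ball subgroups (`a = c₀ − (k+1) − e₂`, `a′ = c₀ − (k+1)`)
  obtain ⟨BF, hBF⟩ := exists_addSubgroup_primePowBall (K := v.adicCompletion F) (c₀ - (k + 1) - e₂)
  obtain ⟨BF', hBF'⟩ := exists_addSubgroup_primePowBall (K := v.adicCompletion F) (c₀ - (k + 1) - e₂ + 1)
  obtain ⟨BE, hBE⟩ := exists_addSubgroup_primePowBall (K := w₀.1.adicCompletion E) (c₀ - (k + 1))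
  obtain ⟨BE', hBE'⟩ := exists_addSubgroup_primePowBall (K := w₀.1.adicCompletion E) (c₀ - (k + 1) + 1)
  obtain ⟨BG, hBG⟩ := exists_addSubgroup_primePowBall (K := (PlacesOver.galInv c w₀).1.adicCompletion E) (c₀ - (k + 1))
  obtain ⟨BG', hBG'⟩ := exists_addSubgroup_primePowBall (K := (PlacesOver.galInv c w₀).1.adicCompletion E) (c₀ - (k + 1) + 1)
  -- skewness and the diagonal coordinates on `X := 𝔰 ∩ Λ_{k+1}`
  have hskew : ∀ x : ↥(S ⊓ Λ₁), (gramS F E v 2 T₀ * (x : Matrix (Fin 2) (Fin 2) (LocalRing E v))).map (conjLocal E c v) =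
      -(gramS F E v 2 T₀ * (x : Matrix (Fin 2) (Fin 2) (LocalRing E v)))ᵀ :=
    fun x => (map_conj_mul_eq_neg_transpose_iff F E c v hT₀ _).1 ((hS _).1 (AddSubgroup.mem_inf.1 x.2).1)
  have hex : ∀ (x : ↥(S ⊓ Λ₁)) (i : Fin 2), ∃! b : v.adicCompletion F,
      (gramS F E v 2 T₀ * (x : Matrix (Fin 2) (Fin 2) (LocalRing E v))) i i = toLocalRing E v b * algebraMap E (LocalRing E v) δ :=
    fun x i => existsUnique_diag_coord F E c hcδ hδ v hT₀ S hS (AddSubgroup.mem_inf.1 x.2).1 i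
  choose b hb hbu using hex
  have hmem₁ : ∀ x : ↥(S ⊓ Λ₁), b x 0 ∈ primePowBall (v.adicCompletion F) (c₀ - (k + 1) - e₂) ∧ b x 1 ∈ primePowBall (v.adicCompletion F) (c₀ - (k + 1) - e₂) ∧
      (gramS F E v 2 T₀ * (x : Matrix (Fin 2) (Fin 2) (LocalRing E v))) 0 1 w₀ ∈ primePowBall (w₀.1.adicCompletion E) (c₀ - (k + 1)) ∧
      (gramS F E v 2 T₀ * (x : Matrix (Fin 2) (Fin 2) (LocalRing E v))) 0 1 (PlacesOver.galInv c w₀) ∈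
        primePowBall ((PlacesOver.galInv c w₀).1.adicCompletion E) (c₀ - (k + 1)) := by
    intro x
    have hx : (x : Matrix (Fin 2) (Fin 2) (LocalRing E v)) ∈ (Λ₁ : Set (Matrix (Fin 2) (Fin 2) (LocalRing E v))) := (AddSubgroup.mem_inf.1 x.2).2
    rw [hΛ₁] at hx
    exact (mem_box_iff_coords_split F E c v hπ w₀ hw₀ hδu c₀ e₂ (k + 1) (hskew x) (hb x 0) (hb x 1)).1 hx
  have hbadd : ∀ (x y : ↥(S ⊓ Λ₁)) (i : Fin 2), b (x + y) i = b x i + b y i := by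
    intro x y i
    refine (hbu (x + y) i (b x i + b y i) ?_).symm
    simp only [AddSubgroup.coe_add, Matrix.mul_add, Matrix.add_apply, hb x i, hb y i, map_add, add_mul]
  -- the coordinate map `f : X →+ (BF⁄BF′)² × BE⁄BE′ × BG⁄BG′` (opaque, by its values)
  obtain ⟨f₀, hf₀⟩ : ∃ f₀ : ↥(S ⊓ Λ₁) → ↥BF, ∀ x, (f₀ x : v.adicCompletion F) = b x 0 :=
    ⟨fun x => ⟨b x 0, by rw [← SetLike.mem_coe, hBF]; exact (hmem₁ x).1⟩, fun x => rfl⟩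
  obtain ⟨f₁, hf₁⟩ : ∃ f₁ : ↥(S ⊓ Λ₁) → ↥BF, ∀ x, (f₁ x : v.adicCompletion F) = b x 1 :=
    ⟨fun x => ⟨b x 1, by rw [← SetLike.mem_coe, hBF]; exact (hmem₁ x).2.1⟩, fun x => rfl⟩
  obtain ⟨f₂, hf₂⟩ : ∃ f₂ : ↥(S ⊓ Λ₁) → ↥BE, ∀ x, (f₂ x : w₀.1.adicCompletion E) = (gramS F E v 2 T₀ * x.1) 0 1 w₀ :=
    ⟨fun x => ⟨(gramS F E v 2 T₀ * x.1) 0 1 w₀, by rw [← SetLike.mem_coe, hBE]; exact (hmem₁ x).2.2.1⟩, fun x => rfl⟩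
  obtain ⟨f₃, hf₃⟩ : ∃ f₃ : ↥(S ⊓ Λ₁) → ↥BG, ∀ x, (f₃ x : (PlacesOver.galInv c w₀).1.adicCompletion E) = (gramS F E v 2 T₀ * x.1) 0 1 (PlacesOver.galInv c w₀) :=
    ⟨fun x => ⟨(gramS F E v 2 T₀ * x.1) 0 1 (PlacesOver.galInv c w₀), by rw [← SetLike.mem_coe, hBG]; exact (hmem₁ x).2.2.2⟩, fun x => rfl⟩
  have hf₀add : ∀ x y, f₀ (x + y) = f₀ x + f₀ y := fun x y => Subtype.ext (by rw [AddMemClass.coe_add, hf₀, hf₀, hf₀, hbadd])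
  have hf₁add : ∀ x y, f₁ (x + y) = f₁ x + f₁ y := fun x y => Subtype.ext (by rw [AddMemClass.coe_add, hf₁, hf₁, hf₁, hbadd])
  have hf₂add : ∀ x y, f₂ (x + y) = f₂ x + f₂ y := fun x y => Subtype.ext (by
    rw [AddMemClass.coe_add, hf₂, hf₂, hf₂, AddSubgroup.coe_add, Matrix.mul_add, Matrix.add_apply, Pi.add_apply])
  have hf₃add : ∀ x y, f₃ (x + y) = f₃ x + f₃ y := fun x y => Subtype.ext (by
    rw [AddMemClass.coe_add, hf₃, hf₃, hf₃, AddSubgroup.coe_add, Matrix.mul_add, Matrix.add_apply, Pi.add_apply])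
  obtain ⟨f, hfapply⟩ : ∃ f : ↥(S ⊓ Λ₁) →+ (↥BF ⧸ BF'.addSubgroupOf BF) × (↥BF ⧸ BF'.addSubgroupOf BF) × (↥BE ⧸ BE'.addSubgroupOf BE) × (↥BG ⧸ BG'.addSubgroupOf BG),
      ∀ x, f x = ((f₀ x : ↥BF ⧸ BF'.addSubgroupOf BF), (f₁ x : ↥BF ⧸ BF'.addSubgroupOf BF), (f₂ x : ↥BE ⧸ BE'.addSubgroupOf BE),
        (f₃ x : ↥BG ⧸ BG'.addSubgroupOf BG)) :=
    ⟨AddMonoidHom.mk' (fun x => ((f₀ x : ↥BF ⧸ BF'.addSubgroupOf BF), (f₁ x : ↥BF ⧸ BF'.addSubgroupOf BF), (f₂ x : ↥BE ⧸ BE'.addSubgroupOf BE),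
        (f₃ x : ↥BG ⧸ BG'.addSubgroupOf BG)))
      (fun x y => by rw [Prod.mk_add_mk, Prod.mk_add_mk, Prod.mk_add_mk, hf₀add, hf₁add, hf₂add, hf₃add, QuotientAddGroup.mk_add, QuotientAddGroup.mk_add,
        QuotientAddGroup.mk_add, QuotientAddGroup.mk_add]),
     fun x => rfl⟩
  -- its kernel is `𝔰 ∩ Λ_k`
  have hker : f.ker = (S ⊓ Λ₀).addSubgroupOf (S ⊓ Λ₁) := by
    ext x
    have hbox := mem_box_iff_coords_split F E c v hπ w₀ hw₀ hδu c₀ e₂ k (hskew x) (hb x 0) (hb x 1)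
    rw [AddMonoidHom.mem_ker, hfapply, Prod.mk_eq_zero, Prod.mk_eq_zero, Prod.mk_eq_zero, QuotientAddGroup.eq_zero_iff, QuotientAddGroup.eq_zero_iff,
      QuotientAddGroup.eq_zero_iff, QuotientAddGroup.eq_zero_iff, AddSubgroup.mem_addSubgroupOf, AddSubgroup.mem_addSubgroupOf, AddSubgroup.mem_addSubgroupOf,
      AddSubgroup.mem_addSubgroupOf, AddSubgroup.mem_addSubgroupOf, AddSubgroup.mem_inf]
    have e0 : ((f₀ x : ↥BF) : v.adicCompletion F) ∈ BF' ↔ b x 0 ∈ primePowBall (v.adicCompletion F) (c₀ - k - e₂) := by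
      rw [← SetLike.mem_coe, hBF', hf₀, show c₀ - (k + 1) - e₂ + 1 = c₀ - k - e₂ by ring]
    have e1 : ((f₁ x : ↥BF) : v.adicCompletion F) ∈ BF' ↔ b x 1 ∈ primePowBall (v.adicCompletion F) (c₀ - k - e₂) := by
      rw [← SetLike.mem_coe, hBF', hf₁, show c₀ - (k + 1) - e₂ + 1 = c₀ - k - e₂ by ring]
    have e2 : ((f₂ x : ↥BE) : w₀.1.adicCompletion E) ∈ BE' ↔
        (gramS F E v 2 T₀ * x.1) 0 1 w₀ ∈ primePowBall (w₀.1.adicCompletion E) (c₀ - k) := by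
      rw [← SetLike.mem_coe, hBE', hf₂, show c₀ - (k + 1) + 1 = c₀ - k by ring]
    have e3 : ((f₃ x : ↥BG) : (PlacesOver.galInv c w₀).1.adicCompletion E) ∈ BG' ↔
        (gramS F E v 2 T₀ * x.1) 0 1 (PlacesOver.galInv c w₀) ∈ primePowBall ((PlacesOver.galInv c w₀).1.adicCompletion E) (c₀ - k) := by
      rw [← SetLike.mem_coe, hBG', hf₃, show c₀ - (k + 1) + 1 = c₀ - k by ring]
    have hx₀ : x.1 ∈ Λ₀ ↔
        b x 0 ∈ primePowBall (v.adicCompletion F) (c₀ - k - e₂) ∧ b x 1 ∈ primePowBall (v.adicCompletion F) (c₀ - k - e₂) ∧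
          (gramS F E v 2 T₀ * x.1) 0 1 w₀ ∈ primePowBall (w₀.1.adicCompletion E) (c₀ - k) ∧
          (gramS F E v 2 T₀ * x.1) 0 1 (PlacesOver.galInv c w₀) ∈ primePowBall ((PlacesOver.galInv c w₀).1.adicCompletion E) (c₀ - k) := by
      rw [← SetLike.mem_coe, hΛ₀]; exact hbox
    rw [e0, e1, e2, e3, hx₀]
    exact ⟨fun h => ⟨(AddSubgroup.mem_inf.1 x.2).1, h.1, h.2.1, h.2.2.1, h.2.2.2⟩, fun h => ⟨h.2.1, h.2.2.1, h.2.2.2.1, h.2.2.2.2⟩⟩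
  -- it is onto
  have hsurj : Function.Surjective f := by
    rintro ⟨q₀, q₁, q₂, q₃⟩
    obtain ⟨β₀, rfl⟩ := QuotientAddGroup.mk_surjective q₀
    obtain ⟨β₁, rfl⟩ := QuotientAddGroup.mk_surjective q₁
    obtain ⟨ζ, rfl⟩ := QuotientAddGroup.mk_surjective q₂
    obtain ⟨ζ', rfl⟩ := QuotientAddGroup.mk_surjective q₃
    obtain ⟨z, hz, hz'⟩ : ∃ z : LocalRing E v, z w₀ = (ζ : w₀.1.adicCompletion E) ∧ z (PlacesOver.galInv c w₀) = (ζ' : (PlacesOver.galInv c w₀).1.adicCompletion E) := by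
      refine ⟨Pi.single (M := fun w : PlacesOver E v => w.1.adicCompletion E) w₀ (ζ : w₀.1.adicCompletion E) +
        Pi.single (M := fun w : PlacesOver E v => w.1.adicCompletion E) (PlacesOver.galInv c w₀) (ζ' : (PlacesOver.galInv c w₀).1.adicCompletion E), ?_, ?_⟩
      · rw [Pi.add_apply, Pi.single_eq_same, Pi.single_eq_of_ne (M := fun w : PlacesOver E v => w.1.adicCompletion E) hne.symm, add_zero]
      · rw [Pi.add_apply, Pi.single_eq_of_ne (M := fun w : PlacesOver E v => w.1.adicCompletion E) hne, Pi.single_eq_same, zero_add]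
    obtain ⟨t, htskew, hb₀', hb₁', h01⟩ := exists_skew_with_coords F E c hcδ hδ v hT₀ hT₀d (β₀ : v.adicCompletion F) (β₁ : v.adicCompletion F) z
    have h01' : (gramS F E v 2 T₀ * t) 0 1 w₀ = (ζ : w₀.1.adicCompletion E) := by rw [h01, hz]
    have h01'' : (gramS F E v 2 T₀ * t) 0 1 (PlacesOver.galInv c w₀) = (ζ' : (PlacesOver.galInv c w₀).1.adicCompletion E) := by rw [h01, hz']
    have htS : t ∈ S := (hS t).2 ((map_conj_mul_eq_neg_transpose_iff F E c v hT₀ t).2 htskew)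
    have hβ₀ : (β₀ : v.adicCompletion F) ∈ primePowBall (v.adicCompletion F) (c₀ - (k + 1) - e₂) := by
      have h := β₀.2; rw [← SetLike.mem_coe, hBF] at h; exact h
    have hβ₁ : (β₁ : v.adicCompletion F) ∈ primePowBall (v.adicCompletion F) (c₀ - (k + 1) - e₂) := by
      have h := β₁.2; rw [← SetLike.mem_coe, hBF] at h; exact h
    have hζ : (ζ : w₀.1.adicCompletion E) ∈ primePowBall (w₀.1.adicCompletion E) (c₀ - (k + 1)) := by
      have h := ζ.2; rw [← SetLike.mem_coe, hBE] at h; exact h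
    have hζ' : (ζ' : (PlacesOver.galInv c w₀).1.adicCompletion E) ∈ primePowBall ((PlacesOver.galInv c w₀).1.adicCompletion E) (c₀ - (k + 1)) := by
      have h := ζ'.2; rw [← SetLike.mem_coe, hBG] at h; exact h
    have htΛ : t ∈ Λ₁ := by
      rw [← SetLike.mem_coe, hΛ₁]
      exact (mem_box_iff_coords_split F E c v hπ w₀ hw₀ hδu c₀ e₂ (k + 1) htskew hb₀' hb₁').2 ⟨hβ₀, hβ₁, by rw [h01']; exact hζ, by rw [h01'']; exact hζ'⟩
    have hx : t ∈ S ⊓ Λ₁ := AddSubgroup.mem_inf.2 ⟨htS, htΛ⟩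
    have e0 : f₀ ⟨t, hx⟩ = β₀ := Subtype.ext (by rw [hf₀]; exact (hbu ⟨t, hx⟩ 0 (β₀ : v.adicCompletion F) hb₀').symm)
    have e1 : f₁ ⟨t, hx⟩ = β₁ := Subtype.ext (by rw [hf₁]; exact (hbu ⟨t, hx⟩ 1 (β₁ : v.adicCompletion F) hb₁').symm)
    have e2 : f₂ ⟨t, hx⟩ = ζ := Subtype.ext (by rw [hf₂]; exact h01')
    have e3 : f₃ ⟨t, hx⟩ = ζ' := Subtype.ext (by rw [hf₃]; exact h01'')
    exact ⟨⟨t, hx⟩, by rw [hfapply, e0, e1, e2, e3]⟩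
  -- count
  have hcount := natCard_quotient_ker f hsurj
  rw [hker, Nat.card_prod, Nat.card_prod, Nat.card_prod] at hcount
  have hqF : Nat.card (↥BF ⧸ BF'.addSubgroupOf BF) = v.residueCard := by
    rw [← AddSubgroup.index, ← AddSubgroup.relIndex, relIndex_eq_residueFieldCard hBF hBF', residueFieldCard_adicCompletion_eq F v]
  have hqE : Nat.card (↥BE ⧸ BE'.addSubgroupOf BE) = v.residueCard := by
    rw [← AddSubgroup.index, ← AddSubgroup.relIndex, relIndex_eq_residueFieldCard hBE hBE', residueFieldCard_adicCompletion_eq E w₀.1,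
      residueCard_eq_of_split F E c v w₀ hw₀]
  have hqG : Nat.card (↥BG ⧸ BG'.addSubgroupOf BG) = v.residueCard := by
    rw [← AddSubgroup.index, ← AddSubgroup.relIndex, relIndex_eq_residueFieldCard hBG hBG', residueFieldCard_adicCompletion_eq E (PlacesOver.galInv c w₀).1,
      residueCard_eq_of_split F E c v (PlacesOver.galInv c w₀) (smul_ne_of_split F E c v w₀ hw₀ (PlacesOver.galInv c w₀))]
  rw [AddSubgroup.relIndex, AddSubgroup.index, hcount, hqF, hqE, hqG]
  ring

/-! ## §3 `[𝔰 ∩ Λ_m : 𝔰 ∩ Λ_0] = q_v^{4m}` at a split place — the consumer's `hcard` -/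

include hcδ hδ hπ hT₀ hT₀d hS hw₀ in
/-- **`[𝔰 ∩ Λ_m : 𝔰 ∩ Λ_0] = q_v^{4m}` AT A SPLIT PLACE** for the ★ (B) boxes `Λ_j` (given by their carriers): iterate §2 along the nested chain (★ `box_mono`,
Mathlib `AddSubgroup.relIndex_mul_relIndex`). [cite: Shimura1997, §13.2] [cite: BushnellHenniart2006, §1.1] -/
theorem relIndex_inf_box_eq_pow_split (hδu : ∀ w : PlacesOver E v, Valued.v (algebraMap E (LocalRing E v) δ w) = 1) (c₀ e₂ : ℤ)
    (Λ : ℤ → AddSubgroup (Matrix (Fin 2) (Fin 2) (LocalRing E v)))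
    (hΛ : ∀ j : ℤ, (Λ j : Set (Matrix (Fin 2) (Fin 2) (LocalRing E v))) = {t | ∀ i i' (w : PlacesOver E v),
      Valued.v ((algebraMap E (LocalRing E v) δ • (gramS F E v 2 T₀ * t)) i i' w) ≤ Valued.v (toPlace v w π) ^ (c₀ - j - if i = i' then e₂ else 0)})
    (m : ℕ) : (S ⊓ Λ 0).relIndex (S ⊓ Λ m) = v.residueCard ^ (4 * m) := by
  have hle : ∀ j j' : ℤ, j ≤ j' → S ⊓ Λ j ≤ S ⊓ Λ j' := by
    intro j j' hjj' t ht
    refine AddSubgroup.mem_inf.2 ⟨(AddSubgroup.mem_inf.1 ht).1, ?_⟩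
    have h := (AddSubgroup.mem_inf.1 ht).2
    rw [← SetLike.mem_coe, hΛ] at h ⊢
    exact box_mono F E v hπ δ c₀ e₂ hjj' h
  induction m with
  | zero => rw [Nat.cast_zero, AddSubgroup.relIndex_self, mul_zero, pow_zero]
  | succ m ih =>
    have hstep : (S ⊓ Λ m).relIndex (S ⊓ Λ ((m + 1 : ℕ) : ℤ)) = v.residueCard ^ 4 :=
      relIndex_inf_box_succ_split F E c hcδ hδ v hπ hT₀ hT₀d S hS w₀ hw₀ hδu c₀ e₂ m (hΛ m) (by rw [hΛ, Nat.cast_succ])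
    rw [← AddSubgroup.relIndex_mul_relIndex (S ⊓ Λ 0) (S ⊓ Λ m) (S ⊓ Λ ((m + 1 : ℕ) : ℤ)) (hle _ _ (by positivity)) (hle _ _ (by push_cast; omega)),
      ih, hstep, ← pow_add]
    ring_nf

include hcδ hδ hπ hT₀ hT₀d hS hw₀ in
/-- **THE `hcard` LETTER OF ★ (J)-split AT A SPLIT PLACE**: `Fintype.card (𝔰 ∩ Λ_m ⧸ 𝔰 ∩ Λ_0) = q_v^{4m}`. [cite: Shimura1997, §13.2] [cite: BushnellHenniart2006, §1.1] -/
theorem card_quotient_inf_box_eq_pow_split (hδu : ∀ w : PlacesOver E v, Valued.v (algebraMap E (LocalRing E v) δ w) = 1) (c₀ e₂ : ℤ)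
    (Λ : ℤ → AddSubgroup (Matrix (Fin 2) (Fin 2) (LocalRing E v)))
    (hΛ : ∀ j : ℤ, (Λ j : Set (Matrix (Fin 2) (Fin 2) (LocalRing E v))) = {t | ∀ i i' (w : PlacesOver E v),
      Valued.v ((algebraMap E (LocalRing E v) δ • (gramS F E v 2 T₀ * t)) i i' w) ≤ Valued.v (toPlace v w π) ^ (c₀ - j - if i = i' then e₂ else 0)})
    (m : ℕ) [Fintype (↥(S ⊓ Λ m) ⧸ (S ⊓ Λ 0).addSubgroupOf (S ⊓ Λ m))] :
    Fintype.card (↥(S ⊓ Λ m) ⧸ (S ⊓ Λ 0).addSubgroupOf (S ⊓ Λ m)) = v.residueCard ^ (4 * m) := by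
  rw [← Nat.card_eq_fintype_card, ← AddSubgroup.index, ← AddSubgroup.relIndex]
  exact relIndex_inf_box_eq_pow_split F E c hcδ hδ v hπ hT₀ hT₀d S hS w₀ hw₀ hδu c₀ e₂ Λ hΛ m

end Summit.HodgeConjecture.HodgeConjecture.Cruxes.HLiu418.K2LiuLocalSWDualBoxIndexSplit

end
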